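import Literature.NumberTheory.Automorphic.ArchMultiWallNormalisedObjectSmooth   -- ★ p851118 (this seat): ι-place object jointly `C^∞` off the walls; brings ★ (B-par), ★ (ELL-∞)/(ELL-∞-UNIF) heads, Hörmander engine
import Literature.Analysis.Calculus.ContDiffBoundedFamilyLpInfty                 -- ★ (B2a) p850983 (LH7-p02 (g4)): `exists_contDiff_hasCompactSupport_lpInfty_of_uniform_bounds`
import Literature.Analysis.Calculus.ParametricIntegralCurryJets                   -- ★ (B1′) p850993 (this seat): `iteratedFDeriv_integral_eq_of_support_local`
import Literature.Analysis.Calculus.IteratedFDerivNestedPartials                  -- ★ p850958 (LH7-p02 (g4)): nested partials ↔ jet entries, sorted basis words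
import Literature.Analysis.Calculus.IteratedFDerivNestedDirectional              -- ★ (LH7-p02): `iteratedFDeriv_comp_clm_add_apply_of_isOpen` (local chain rule on the right)
import Mathlib.MeasureTheory.Constructions.Pi
import HarnessLib

/-!
# Tools for the multi-wall Casimir step: the `ℓ^∞` device over an ARBITRARY `C^∞`-bounded family on the fixed punctured window, Option-Fubini for the
# multi-place orbital integrand, jets in the smooth slot under an integral along a proper datum (Varadarajan 1989 §6.4; Bouaziz 1994 §3.1 (I₂); Hörmander Thm. 1.1.9)

Topic `NumberTheory/Automorphic`; namespaces `Literature.NumberTheory.Automorphic.RankOneCasimir` (§1, §2, §4) and `Literature.Analysis.Calculus` (§3, frame-free).  THEOREMS ONLY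
(no `def`, no instance, no notation, no axiom, no named fact, no `sorry`); kernel lane `--kind proof --supports stmt-HodgeConjecture-24833`.  Cell `pub/hodgecm-mathlib`, crux H413
(`stmt-HodgeConjecture-24833`), line LH3 (closer stub `stub_N9`, direct road), letter L3′ organ O-L3′ (ii), (α4) «all-orders transport», stage **(α4-S6) «MULTI-WALL base points»**
(frozen invariant v4 `F0/P3c/LH10/LH10-p01/g4/s6/MultiWallInvFrozen.v4.LH10p01g4.lean`, adopted by the (S7) consumer LH3-p01 (g5) 2026-09-02T10:55Z), brick (S6-B5b) part 1 = the
three tools the induction step `ι → Option ι` is assembled from.  Seat LH10-p01 (g4).  Count-neutral.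

* §1 **`exists_forall_norm_iteratedDeriv_orbitalIntegral_le_of_uniform_family`** — THE `ℓ^∞` DEVICE.  ★ (ELL-∞) `exists_forall_eventually_norm_iteratedDeriv_orbitalIntegral_le` bounds
  the `ψ`-jets of `F f = 2 sin ψ · ∫ f(↑↑(h t_z(ψ) h⁻¹)) dμ` near the wall for ONE `f ∈ C_c^∞(M₂(ℂ), E′)`, `E′` any Banach space.  A family `(g_j)_{j ∈ J}` (ANY index type `J`, no
  topology) of `C^∞` functions with ONE compact support and jets of every order bounded UNIFORMLY in `j` is ONE `G ∈ C_c^∞(M₂(ℂ), ℓ^∞(J, E))` (★ (B2a) p850983); the engine at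
  `E′ := ℓ^∞(J, E)`, regular smoothness away from the wall (★ (B-par) `contDiffOn_orbitalIntegral_param`, `1 < π`) and `ev_j ∘` (★ `iteratedDeriv_orbitalIntegral_comp_clm`,
  `‖ev_j‖ ≤ 1`) give ONE `B` with `‖(F (g_j))⁽ᵏ⁾ (t)‖ ≤ B` for ALL `0 < |t| < 1` and ALL `j` — the FIXED punctured unit window on which the multi-wall induction closes.
* §2 **`multiOrbitalIntegral_option_eq_integral_integral`** — Option-Fubini for the `(Option ι)`-place orbital integrand at a regular angle vector (outer place `none`; Mathlib
  `Measure.pi_map_piOptionEquivProd`, integrability from ★ p851118's compact support; cf. ★ p851140 `PiOptionIntegral` (LH10-p02 (g6)) for the general toolkit).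
* §3 **`Literature.Analysis.Calculus.iteratedFDeriv_integral_slot_of_proper`** (frame-free) — for `Y : A → M` continuous and proper onto compacta, `μ` finite on compacts, and
  `Ψ : M × Z → E` `C^∞` on `univ ×ˢ U` vanishing off `K₀ × Z`: `ζ ↦ ∫ Ψ(Y a, ζ) dμ` is `C^∞` on `U`, `D^l_ζ ∫ = ∫ D^l_ζ`, and the jet integrand is integrable (★ B1′-local p850993).
* §4 **`isCompact_preimage_conj_torusPoint`** — `h ↦ ↑↑(h t_z(t) h⁻¹)` is proper onto compacta at a regular angle (★ `isCompact_setOf_exists_conj_circleDiagonal_mem`), the datum of §3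
  for the outer place of the step.
HONEST LABEL: HC_CM is proved only modulo the 7 printed citations (2 remaining: hLiu418 = `stmt-HodgeConjecture-24832`, h413 = `stmt-HodgeConjecture-24833`) until rung 0 closes;
bookkeeping over ★ engines, count-neutral, pays nothing by itself.

## References
* [Varadarajan1989] V. S. Varadarajan, *An Introduction to Harmonic Analysis on Semisimple Lie Groups* (1989), §6.4 Thms 22–24.
* [Bouaziz1994IntegralesOrbitales] A. Bouaziz, *Intégrales orbitales sur les groupes de Lie réductifs*, Ann. Sci. ÉNS 27 (1994), §3.1 (I₁)–(I₂) p. 579.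
* [HormanderALPDO1] L. Hörmander, *The Analysis of Linear Partial Differential Operators I*, 2nd ed. (1990), §1.1 Thm. 1.1.9, §2.1.
* [Rogawski1990] J. D. Rogawski, *Automorphic Representations of Unitary Groups in Three Variables*, Ann. of Math. Stud. 123 (1990), §8.2 pp. 119–123.
* [Dieudonne1960] J. Dieudonné, *Foundations of Modern Analysis* (1960), (8.11.2).
-/

set_option autoImplicit false

noncomputable section

namespace Literature.NumberTheory.Automorphic.RankOneCasimir

open _root_.Complex _root_.Matrix _root_.MeasureTheory _root_.Set _root_.Filter _root_.Topology _root_.NumberField _root_.NumberField.InfinitePlace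
open _root_.Literature.NumberTheory.Automorphic _root_.Literature.NumberTheory.Automorphic.UnitaryGroup _root_.Literature.Analysis.Calculus
open scoped Matrix.Norms.Operator MatrixGroups ComplexConjugate ContDiff Real

/-! ## §1 The `ℓ^∞` device: uniform jets over an arbitrary `C^∞`-bounded family, on the FIXED punctured window `0 < |t| < 1` -/

section Family

variable (L : Type) [Field L] (a : Fin 2 → L) (w : {w : InfinitePlace L // IsComplex w})

/-- **UNIFORM JETS OVER AN ARBITRARY `C^∞`-BOUNDED FAMILY ON THE FIXED PUNCTURED WINDOW.**  `G₂ = U(σ_w diag a)(ℂ)` of signature `(1,1)` (frame of ★ (ELL-∞)), `μ` Haar and right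
invariant, `F` the normalised orbital integral at the centre `z` (hypothesis `hF`).  For a family `g : J → M₂(ℂ) → E` (`J` ANY type, `E` Banach) of `C^∞` functions vanishing off ONE compact
`K₀` with `‖Dᵐ (g j)‖ ≤ B_m` for every `m` uniformly in `j`, and every `k`: there is `B` with **`‖(F (g j))⁽ᵏ⁾ (t)‖ ≤ B` for all `0 < |t| < 1` and all `j`** (★ (B2a): the family is one
`G ∈ C_c^∞(M₂, ℓ^∞(J,E))`; ★ (ELL-∞) at `E′ = ℓ^∞(J,E)` near the wall; ★ (B-par) regular smoothness on `{sin ≠ 0} ⊇ {δ ≤ |t| ≤ 1}` (`1 < π`); `F (g j) = ev_j ∘ F′ G` through ★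
`iteratedDeriv_orbitalIntegral_comp_clm`, `‖ev_j‖ ≤ 1`). [cite: Bouaziz1994IntegralesOrbitales, §3.1 (I₁)–(I₂) p. 579] [cite: Varadarajan1989, §6.4 Thm 22] [cite: HormanderALPDO1, §2.1] -/
theorem exists_forall_norm_iteratedDeriv_orbitalIntegral_le_of_uniform_family
    (ha : ∀ i, a i ≠ 0) (hreal : ∀ i, (w.1.embedding (a i)).im = 0) (hsgn : (w.1.embedding (a 0)).re * (w.1.embedding (a 1)).re < 0)
    {p q : ℝ} (hpq : p * q = 1) (hqe : (q : ℂ) ^ 2 * w.1.embedding (a 1) = -w.1.embedding (a 0))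
    [MeasurableSpace (unitaryGroupOfForm (starRingEnd ℂ) ((Matrix.diagonal a).map w.1.embedding))]
    [BorelSpace (unitaryGroupOfForm (starRingEnd ℂ) ((Matrix.diagonal a).map w.1.embedding))]
    (μ : Measure (unitaryGroupOfForm (starRingEnd ℂ) ((Matrix.diagonal a).map w.1.embedding))) [μ.IsHaarMeasure] [μ.IsMulRightInvariant]
    (z : Circle) {E : Type} [NormedAddCommGroup E] [NormedSpace ℝ E] [CompleteSpace E]
    (F : (Matrix (Fin 2) (Fin 2) ℂ → E) → ℝ → E)
    (hF : ∀ (f : Matrix (Fin 2) (Fin 2) ℂ → E) (ψ : ℝ), F f ψ = (2 * Real.sin ψ) •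
      ∫ h : unitaryGroupOfForm (starRingEnd ℂ) ((Matrix.diagonal a).map w.1.embedding),
        f (((h * ⟨circleDiagonal 2 ![z * Circle.exp ψ, z * Circle.exp (-ψ)], circleDiagonal_mem_archLocal_diagonal L 2 a w _⟩ * h⁻¹ :
          unitaryGroupOfForm (starRingEnd ℂ) ((Matrix.diagonal a).map w.1.embedding)) : GL (Fin 2) ℂ) : Matrix (Fin 2) (Fin 2) ℂ) ∂μ)
    {J : Type} (g : J → Matrix (Fin 2) (Fin 2) ℂ → E) (hg : ∀ j, ContDiff ℝ ∞ (g j))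
    (hbd : ∀ m : ℕ, ∃ B : ℝ, ∀ (j : J) (Y : Matrix (Fin 2) (Fin 2) ℂ), ‖iteratedFDeriv ℝ m (g j) Y‖ ≤ B)
    {K₀ : Set (Matrix (Fin 2) (Fin 2) ℂ)} (hK₀ : IsCompact K₀) (hsupp : ∀ (j : J) (Y : Matrix (Fin 2) (Fin 2) ℂ), Y ∉ K₀ → g j Y = 0) (k : ℕ) :
    ∃ B : ℝ, ∀ t : ℝ, 0 < |t| → |t| < 1 → ∀ j : J, ‖iteratedDeriv k (F (g j)) t‖ ≤ B := by
  -- ★ (B2a): the family is ONE `C_c^∞` function `G` with values in `ℓ^∞(J, E)`, `ev_j ∘ G = g j`, `‖ev_j‖ ≤ 1`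
  obtain ⟨G, hGg, hGs, hGc, -, hev⟩ := exists_contDiff_hasCompactSupport_lpInfty_of_uniform_bounds g hg hbd hK₀ hsupp
  -- the `ℓ^∞(J, E)`-valued functional (defining formula)
  obtain ⟨F', hF'⟩ : ∃ F' : (Matrix (Fin 2) (Fin 2) ℂ → lp (fun _ : J => E) ⊤) → ℝ → lp (fun _ : J => E) ⊤,
      ∀ (f : Matrix (Fin 2) (Fin 2) ℂ → lp (fun _ : J => E) ⊤) (ψ : ℝ), F' f ψ = (2 * Real.sin ψ) •
        ∫ h : unitaryGroupOfForm (starRingEnd ℂ) ((Matrix.diagonal a).map w.1.embedding),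
          f (((h * ⟨circleDiagonal 2 ![z * Circle.exp ψ, z * Circle.exp (-ψ)], circleDiagonal_mem_archLocal_diagonal L 2 a w _⟩ * h⁻¹ :
            unitaryGroupOfForm (starRingEnd ℂ) ((Matrix.diagonal a).map w.1.embedding)) : GL (Fin 2) ℂ) : Matrix (Fin 2) (Fin 2) ℂ) ∂μ := ⟨_, fun _ _ => rfl⟩
  -- NEAR THE WALL: ★ (ELL-∞) at `E′ := ℓ^∞(J, E)` (Casimir operator by its defining formula)
  obtain ⟨B₁, hB₁⟩ := exists_forall_eventually_norm_iteratedDeriv_orbitalIntegral_le L a w ha hreal hsgn hpq hqe μ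
    (fun (g' : Matrix (Fin 2) (Fin 2) ℂ → lp (fun _ : J => E) ⊤) (Y : Matrix (Fin 2) (Fin 2) ℂ) =>
      -(fderiv ℝ (fderiv ℝ g') Y (Y * !![I, 0; 0, -I]) (Y * !![I, 0; 0, -I]) + fderiv ℝ g' Y (Y * !![I, 0; 0, -I] * !![I, 0; 0, -I])) +
        (fderiv ℝ (fderiv ℝ g') Y (Y * !![(0 : ℂ), (p : ℂ); (q : ℂ), 0]) (Y * !![(0 : ℂ), (p : ℂ); (q : ℂ), 0]) +
          fderiv ℝ g' Y (Y * !![(0 : ℂ), (p : ℂ); (q : ℂ), 0] * !![(0 : ℂ), (p : ℂ); (q : ℂ), 0])) +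
        (fderiv ℝ (fderiv ℝ g') Y (Y * !![(0 : ℂ), -((p : ℂ) * I); (q : ℂ) * I, 0]) (Y * !![(0 : ℂ), -((p : ℂ) * I); (q : ℂ) * I, 0]) +
          fderiv ℝ g' Y (Y * !![(0 : ℂ), -((p : ℂ) * I); (q : ℂ) * I, 0] * !![(0 : ℂ), -((p : ℂ) * I); (q : ℂ) * I, 0])))
    (fun _ _ => rfl) z F' hF' hGs hGc k
  obtain ⟨δ, hδ, hnear⟩ : ∃ δ > 0, ∀ t : ℝ, |t| < δ → t ≠ 0 → ‖iteratedDeriv k (F' G) t‖ ≤ B₁ := by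
    obtain ⟨δ, hδ, h⟩ := Metric.eventually_nhds_iff.1 (eventually_nhdsWithin_iff.1 hB₁)
    exact ⟨δ, hδ, fun t ht ht0 => h (by rwa [Real.dist_eq, sub_zero]) ht0⟩
  -- AWAY FROM THE WALL: `F′ G` is `C^∞` on `{sin ≠ 0}` (★ (B-par), dummy parameter), hence its `k`-th derivative is bounded on the compact `{δ ≤ |t| ≤ 1} ⊆ {sin ≠ 0}` (`1 < π`)
  have hG0 : ∀ Y, Y ∉ tsupport G → G Y = 0 := fun Y hY => by
    by_contra h
    exact hY (subset_tsupport _ h)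
  have hreg : ContDiffOn ℝ ∞ (F' G) {t : ℝ | Real.sin t ≠ 0} := by
    have h := contDiffOn_orbitalIntegral_param L a w ha μ z F' hF' (Q := ℝ) (fun _ => G) (hGs.comp contDiff_snd) ⟨tsupport G, hGc, fun _ Y hY => hG0 Y hY⟩
    exact h.comp ((contDiff_const (c := (0 : ℝ))).prodMk contDiff_id).contDiffOn fun t ht => ⟨mem_univ _, ht⟩
  have hopen : IsOpen {t : ℝ | Real.sin t ≠ 0} := isOpen_ne_fun Real.continuous_sin continuous_const
  have hcont : ContinuousOn (iteratedDeriv k (F' G)) {t : ℝ | Real.sin t ≠ 0} :=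
    (hreg.continuousOn_iteratedDerivWithin (m := k) (by exact_mod_cast le_top) hopen.uniqueDiffOn).congr
      fun t ht => (iteratedDerivWithin_of_isOpen hopen ht).symm
  have hS : IsCompact {t : ℝ | δ ≤ |t| ∧ |t| ≤ 1} :=
    (isCompact_Icc : IsCompact (Icc (-1 : ℝ) 1)).of_isClosed_subset (isClosed_Icc.preimage continuous_abs) fun t ht => abs_le.1 ht.2
  have hSsub : {t : ℝ | δ ≤ |t| ∧ |t| ≤ 1} ⊆ {t : ℝ | Real.sin t ≠ 0} := fun t ht => by
    have hπ : (1 : ℝ) < Real.pi := by linarith [Real.pi_gt_three]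
    have ht1 : |t| ≤ 1 := ht.2
    have hne : t ≠ 0 := abs_pos.1 (hδ.trans_le ht.1)
    show Real.sin t ≠ 0
    rw [Ne, Real.sin_eq_zero_iff_of_lt_of_lt (by linarith [neg_abs_le t]) (by linarith [le_abs_self t])]
    exact hne
  obtain ⟨B₂, hB₂⟩ := hS.exists_bound_of_continuousOn (hcont.mono hSsub)
  -- coordinates: `F (g j) = ev_j ∘ F′ G` and `ev_j` passes through `iteratedDeriv` on the punctured window (★ `iteratedDeriv_orbitalIntegral_comp_clm`)
  refine ⟨max B₁ B₂, fun t ht0 ht1 j => ?_⟩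
  obtain ⟨ℓ, hℓ, hℓG⟩ := hev j
  have hgj : g j = fun X => ℓ (G X) := funext fun X => (hℓG X).symm
  have htI : t ∈ Ioo (-1 : ℝ) 1 := ⟨by linarith [neg_abs_le t], by linarith [le_abs_self t]⟩
  rw [hgj, iteratedDeriv_orbitalIntegral_comp_clm L a w ha hreal hsgn hpq hqe μ
    (fun (g' : Matrix (Fin 2) (Fin 2) ℂ → lp (fun _ : J => E) ⊤) (Y : Matrix (Fin 2) (Fin 2) ℂ) =>
      -(fderiv ℝ (fderiv ℝ g') Y (Y * !![I, 0; 0, -I]) (Y * !![I, 0; 0, -I]) + fderiv ℝ g' Y (Y * !![I, 0; 0, -I] * !![I, 0; 0, -I])) +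
        (fderiv ℝ (fderiv ℝ g') Y (Y * !![(0 : ℂ), (p : ℂ); (q : ℂ), 0]) (Y * !![(0 : ℂ), (p : ℂ); (q : ℂ), 0]) +
          fderiv ℝ g' Y (Y * !![(0 : ℂ), (p : ℂ); (q : ℂ), 0] * !![(0 : ℂ), (p : ℂ); (q : ℂ), 0])) +
        (fderiv ℝ (fderiv ℝ g') Y (Y * !![(0 : ℂ), -((p : ℂ) * I); (q : ℂ) * I, 0]) (Y * !![(0 : ℂ), -((p : ℂ) * I); (q : ℂ) * I, 0]) +
          fderiv ℝ g' Y (Y * !![(0 : ℂ), -((p : ℂ) * I); (q : ℂ) * I, 0] * !![(0 : ℂ), -((p : ℂ) * I); (q : ℂ) * I, 0])))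
    (fun _ _ => rfl) z F hF F' hF' ℓ hGs hGc k htI (abs_pos.1 ht0)]
  have hmain : ‖iteratedDeriv k (F' G) t‖ ≤ max B₁ B₂ := by
    by_cases hlt : |t| < δ
    · exact (hnear t hlt (abs_pos.1 ht0)).trans (le_max_left _ _)
    · exact (hB₂ t ⟨not_lt.1 hlt, ht1.le⟩).trans (le_max_right _ _)
  calc ‖ℓ (iteratedDeriv k (F' G) t)‖ ≤ ‖ℓ‖ * ‖iteratedDeriv k (F' G) t‖ := ℓ.le_opNorm _
    _ ≤ 1 * max B₁ B₂ := mul_le_mul hℓ hmain (norm_nonneg _) zero_le_one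
    _ = max B₁ B₂ := one_mul _

end Family

/-! ## §2 Option-Fubini for the `(Option ι)`-place orbital integrand at a regular angle vector -/

section OptionFubini

variable (L : Type) [Field L] (a : Fin 2 → L) {ι : Type} [Fintype ι] (wl : Option ι → {w : InfinitePlace L // IsComplex w}) (z : Option ι → Circle)
variable {E : Type*} [NormedAddCommGroup E] [NormedSpace ℝ E] [CompleteSpace E]

omit [CompleteSpace E] in
/-- **OPTION-FUBINI FOR THE MULTI-PLACE ORBITAL INTEGRAND** (outer place `none`): for `Θ : (Option ι → M₂(ℂ)) → E` continuous vanishing off one compact `C`, Haar `ν_o`, and a REGULAR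
angle vector `ψ` (`sin (ψ o) ≠ 0` for all `o`):
`∫_{Π_o G_o} Θ((↑↑(h_o t_{z_o}(ψ_o) h_o⁻¹))_o) d(Measure.pi ν) = ∫_{G_none} ∫_{Π_i G_{some i}} Θ(none ↦ ↑↑(h₀ t(ψ_none) h₀⁻¹), some i ↦ ↑↑(h_i t(ψ_{some i}) h_i⁻¹)) d(Measure.pi (ν ∘ some)) dν_none`
(Mathlib `Measure.pi_map_piOptionEquivProd` + `integral_map_equiv` + `integral_prod_symm`; integrability from the compact support at the regular `ψ`, ★ p851118). [cite: Varadarajan1989, §6.4]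
[cite: Rogawski1990, §8.2 pp. 122–123] -/
theorem multiOrbitalIntegral_option_eq_integral_integral (ha : ∀ j, a j ≠ 0)
    [∀ o, MeasurableSpace (unitaryGroupOfForm (starRingEnd ℂ) ((Matrix.diagonal a).map (wl o).1.embedding))]
    [∀ o, BorelSpace (unitaryGroupOfForm (starRingEnd ℂ) ((Matrix.diagonal a).map (wl o).1.embedding))]
    (ν : ∀ o, Measure (unitaryGroupOfForm (starRingEnd ℂ) ((Matrix.diagonal a).map (wl o).1.embedding))) [∀ o, (ν o).IsHaarMeasure]
    (Θ : (Option ι → Matrix (Fin 2) (Fin 2) ℂ) → E) (hΘ : Continuous Θ) {C : Set (Option ι → Matrix (Fin 2) (Fin 2) ℂ)} (hC : IsCompact C)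
    (h0 : ∀ W : Option ι → Matrix (Fin 2) (Fin 2) ℂ, W ∉ C → Θ W = 0) (ψ : Option ι → ℝ) (hψ : ∀ o, Real.sin (ψ o) ≠ 0) :
    ∫ h : (∀ o, unitaryGroupOfForm (starRingEnd ℂ) ((Matrix.diagonal a).map (wl o).1.embedding)),
        Θ (fun o => (((h o * ⟨circleDiagonal 2 ![z o * Circle.exp (ψ o), z o * Circle.exp (-(ψ o))], circleDiagonal_mem_archLocal_diagonal L 2 a (wl o) _⟩ * (h o)⁻¹ :
          unitaryGroupOfForm (starRingEnd ℂ) ((Matrix.diagonal a).map (wl o).1.embedding)) : GL (Fin 2) ℂ) : Matrix (Fin 2) (Fin 2) ℂ)) ∂(Measure.pi ν) =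
      ∫ h₀ : unitaryGroupOfForm (starRingEnd ℂ) ((Matrix.diagonal a).map (wl none).1.embedding),
        ∫ h' : (∀ i : ι, unitaryGroupOfForm (starRingEnd ℂ) ((Matrix.diagonal a).map (wl (some i)).1.embedding)),
          Θ (fun o => Option.elim o
            (((h₀ * ⟨circleDiagonal 2 ![z none * Circle.exp (ψ none), z none * Circle.exp (-(ψ none))], circleDiagonal_mem_archLocal_diagonal L 2 a (wl none) _⟩ * h₀⁻¹ :
              unitaryGroupOfForm (starRingEnd ℂ) ((Matrix.diagonal a).map (wl none).1.embedding)) : GL (Fin 2) ℂ) : Matrix (Fin 2) (Fin 2) ℂ)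
            (fun i => (((h' i * ⟨circleDiagonal 2 ![z (some i) * Circle.exp (ψ (some i)), z (some i) * Circle.exp (-(ψ (some i)))],
                circleDiagonal_mem_archLocal_diagonal L 2 a (wl (some i)) _⟩ * (h' i)⁻¹ :
              unitaryGroupOfForm (starRingEnd ℂ) ((Matrix.diagonal a).map (wl (some i)).1.embedding)) : GL (Fin 2) ℂ) : Matrix (Fin 2) (Fin 2) ℂ)))
          ∂(Measure.pi fun i => ν (some i)) ∂(ν none) := by
  haveI : ∀ o, SecondCountableTopology (unitaryGroupOfForm (starRingEnd ℂ) ((Matrix.diagonal a).map (wl o).1.embedding)) := fun o =>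
    secondCountableTopology_archLocal L 2 (Matrix.diagonal a) (wl o)
  haveI : ∀ o, LocallyCompactSpace (unitaryGroupOfForm (starRingEnd ℂ) ((Matrix.diagonal a).map (wl o).1.embedding)) := fun o =>
    locallyCompactSpace_archLocal L 2 (Matrix.diagonal a) (wl o)
  -- the integrand is continuous with compact support (regular `ψ`, ★ p851118), hence integrable against the product Haar measure
  set f : (∀ o, unitaryGroupOfForm (starRingEnd ℂ) ((Matrix.diagonal a).map (wl o).1.embedding)) → E := fun h =>
    Θ (fun o => (((h o * ⟨circleDiagonal 2 ![z o * Circle.exp (ψ o), z o * Circle.exp (-(ψ o))], circleDiagonal_mem_archLocal_diagonal L 2 a (wl o) _⟩ * (h o)⁻¹ :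
      unitaryGroupOfForm (starRingEnd ℂ) ((Matrix.diagonal a).map (wl o).1.embedding)) : GL (Fin 2) ℂ) : Matrix (Fin 2) (Fin 2) ℂ)) with hf
  have hfc : Continuous f := by
    refine hΘ.comp (continuous_pi fun o => ?_)
    exact (Units.continuous_val.comp continuous_subtype_val).comp
      ((((continuous_apply o).mul continuous_const)).mul ((continuous_apply o).inv))
  obtain ⟨W, hW, S, hS, hS0⟩ := exists_isCompact_forall_apply_conj_multiTorusPoint_eq_zero L a wl z ha (X := ℝ) (fun _ : ℝ => Θ) hC (fun _ W hW => h0 W hW) ((0 : ℝ), ψ) hψ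
  have hfs : HasCompactSupport f := HasCompactSupport.intro hS fun h hh => hS0 h hh ((0 : ℝ), ψ) (mem_of_mem_nhds hW)
  have hfi : Integrable f (Measure.pi ν) := hfc.integrable_of_hasCompactSupport hfs
  -- Option-Fubini
  have hpi := Measure.pi_map_piOptionEquivProd ν
  rw [← hpi] at hfi ⊢
  have hfi' := (integrable_map_equiv _ f).1 hfi
  rw [integral_map_equiv]
  refine (integral_prod_symm _ hfi').trans ?_
  refine integral_congr_ae (Eventually.of_forall fun h₀ => integral_congr_ae (Eventually.of_forall fun h' => ?_))
  show f _ = _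
  simp only [hf]
  congr 1
  funext o
  cases o <;> rfl

end OptionFubini

/-! ## §3 Jets in the smooth slot pass under an integral along a PROPER continuous datum (★ B1′-local, frame-free) -/

end Literature.NumberTheory.Automorphic.RankOneCasimir

namespace Literature.Analysis.Calculus

open _root_.MeasureTheory _root_.Set _root_.Filter _root_.Topology
open scoped ContDiff

section Slot

variable {A : Type*} [TopologicalSpace A] [MeasurableSpace A] [OpensMeasurableSpace A] [T2Space A]
variable {M : Type*} [NormedAddCommGroup M] [NormedSpace ℝ M]
variable {Z : Type*} [NormedAddCommGroup Z] [NormedSpace ℝ Z] [FiniteDimensional ℝ Z]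
variable {E : Type*} [NormedAddCommGroup E] [NormedSpace ℝ E] [CompleteSpace E]

omit [CompleteSpace E] in
/-- **JETS IN THE SMOOTH SLOT UNDER AN INTEGRAL ALONG A PROPER DATUM.**  `μ` finite on compacts on a Hausdorff space `A`, `Y : A → M` continuous and PROPER onto compacta
(`Y ⁻¹' K` compact for compact `K`), `Ψ : M × Z → E` (`Z` finite-dimensional, `E` Banach) `C^∞` on `univ ×ˢ U` (`U ⊆ Z` open) and vanishing when the `M`-variable leaves a compact `K₀`.
Then on `U`: (i) `ζ ↦ ∫ Ψ(Y a, ζ) dμ(a)` is `C^∞`; (ii) **`D^l_ζ ∫ Ψ(Y a, ζ) dμ = ∫ D^l_ζ Ψ(Y a, ·)(ζ) dμ`**; (iii) the jet integrand `a ↦ D^l_ζ Ψ(Y a, ·)(ζ)` is integrable (continuous, supported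
in `Y ⁻¹' K₀`).  ★ B1′-local (`contDiffOn_integral_of_support_local`, `iteratedFDeriv_integral_eq_of_support_local`) with the uniform compact support `Y ⁻¹' K₀` and the jets
`D^l Ψ(Y a, ζ) ∘ (inr, …, inr)` (★ `iteratedFDeriv_comp_clm_add_apply_of_isOpen`), jointly continuous.  The orbital use: `A = G₂`, `Y a = ↑↑(a t_z(t) a⁻¹)` at a regular angle (proper by ★
`isCompact_setOf_exists_conj_circleDiagonal_mem`). [cite: HormanderALPDO1, §1.1 Thm. 1.1.9] [cite: Dieudonne1960, (8.11.2)] -/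
theorem iteratedFDeriv_integral_slot_of_proper (μ : Measure A) [IsFiniteMeasureOnCompacts μ] (Y : A → M) (hYc : Continuous Y)
    (hYp : ∀ K : Set M, IsCompact K → IsCompact (Y ⁻¹' K)) (Ψ : M × Z → E) {U : Set Z} (hU : IsOpen U) (hΨ : ContDiffOn ℝ ∞ Ψ ((Set.univ : Set M) ×ˢ U))
    {K₀ : Set M} (hK₀ : IsCompact K₀) (h0 : ∀ (X : M) (ζ : Z), X ∉ K₀ → Ψ (X, ζ) = 0) :
    ContDiffOn ℝ ∞ (fun ζ : Z => ∫ a, Ψ (Y a, ζ) ∂μ) U ∧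
    ∀ (l : ℕ) (ζ : Z), ζ ∈ U →
      iteratedFDeriv ℝ l (fun ζ : Z => ∫ a, Ψ (Y a, ζ) ∂μ) ζ = ∫ a, iteratedFDeriv ℝ l (fun ζ : Z => Ψ (Y a, ζ)) ζ ∂μ ∧
      Integrable (fun a : A => iteratedFDeriv ℝ l (fun ζ : Z => Ψ (Y a, ζ)) ζ) μ := by
  have hV : IsOpen ((Set.univ : Set M) ×ˢ U) := isOpen_univ.prod hU
  -- the slices `ζ ↦ Ψ (Y a, ζ)` and their jets `D^n Ψ (Y a, ζ) ∘ (inr, …, inr)`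
  have hpt : ∀ (a : A) (ζ : Z), ContinuousLinearMap.inr ℝ M Z ζ + (Y a, 0) = (Y a, ζ) := fun a ζ => by
    simp only [ContinuousLinearMap.inr_apply, Prod.mk_add_mk, zero_add, add_zero]
  have hfun : ∀ a : A, (fun ζ : Z => Ψ (Y a, ζ)) = fun ζ => Ψ (ContinuousLinearMap.inr ℝ M Z ζ + (Y a, 0)) := fun a => by
    funext ζ
    rw [hpt]
  have hmem : ∀ (a : A), ∀ ζ ∈ U, ContinuousLinearMap.inr ℝ M Z ζ + (Y a, 0) ∈ (Set.univ : Set M) ×ˢ U := fun a ζ hζ => by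
    rw [hpt]
    exact Set.mk_mem_prod (Set.mem_univ _) hζ
  have hjet : ∀ (n : ℕ) (a : A) (ζ : Z), ζ ∈ U → iteratedFDeriv ℝ n (fun ζ : Z => Ψ (Y a, ζ)) ζ =
      (iteratedFDeriv ℝ n Ψ (Y a, ζ)).compContinuousLinearMap fun _ => ContinuousLinearMap.inr ℝ M Z := by
    intro n a ζ hζ
    ext m
    have key := NestedDirectional.iteratedFDeriv_comp_clm_add_apply_of_isOpen (ContinuousLinearMap.inr ℝ M Z) (Y a, 0) hV hΨ (hmem a ζ hζ)
      (show ((n : ℕ) : WithTop ℕ∞) ≤ ∞ by exact_mod_cast le_top) m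
    rw [hfun a, ContinuousMultilinearMap.compContinuousLinearMap_apply]
    refine key.trans ?_
    rw [hpt]
  have hH : ∀ a : A, ContDiffOn ℝ ∞ (fun ζ : Z => Ψ (Y a, ζ)) U := fun a =>
    hΨ.comp (contDiffOn_const.prodMk contDiffOn_id) fun ζ hζ => ⟨Set.mem_univ _, hζ⟩
  have hc : ∀ n : ℕ, ContinuousOn (fun x : A × Z => iteratedFDeriv ℝ n (fun ζ : Z => Ψ (Y x.1, ζ)) x.2) (Set.univ ×ˢ U) := by
    intro n
    have hcn : ContinuousOn (iteratedFDeriv ℝ n Ψ) ((Set.univ : Set M) ×ˢ U) :=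
      (hΨ.continuousOn_iteratedFDerivWithin (m := n) (by exact_mod_cast le_top) hV.uniqueDiffOn).congr fun x hx => (iteratedFDerivWithin_of_isOpen n hV hx).symm
    have h1 : ContinuousOn (fun x : A × Z =>
        ContinuousMultilinearMap.compContinuousLinearMapL (fun _ : Fin n => ContinuousLinearMap.inr ℝ M Z) (iteratedFDeriv ℝ n Ψ (Y x.1, x.2))) (Set.univ ×ˢ U) :=
      (ContinuousMultilinearMap.compContinuousLinearMapL fun _ : Fin n => ContinuousLinearMap.inr ℝ M Z).continuous.comp_continuousOn
        (hcn.comp ((hYc.comp continuous_fst).prodMk continuous_snd).continuousOn fun x hx => ⟨Set.mem_univ _, hx.2⟩)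
    refine h1.congr fun x hx => ?_
    rw [hjet n x.1 x.2 hx.2]
    rfl
  -- uniform compact support `Y ⁻¹' K₀`
  have hloc : ∀ ζ₀ ∈ U, ∃ V : Set Z, IsOpen V ∧ ζ₀ ∈ V ∧ V ⊆ U ∧ ∃ C : Set A, IsCompact C ∧ ∀ a, a ∉ C → ∀ ζ ∈ V, Ψ (Y a, ζ) = 0 :=
    fun ζ₀ hζ₀ => ⟨U, hU, hζ₀, Set.Subset.rfl, Y ⁻¹' K₀, hYp K₀ hK₀, fun a ha ζ _ => h0 (Y a) ζ ha⟩
  refine ⟨contDiffOn_integral_of_support_local (μ := μ) hU hH hc hloc, fun l ζ hζ => ⟨iteratedFDeriv_integral_eq_of_support_local (μ := μ) hU hH hc hloc l hζ, ?_⟩⟩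
  -- integrability of the jet integrand at `ζ`: continuous with compact support
  have hcont : Continuous fun a : A => iteratedFDeriv ℝ l (fun ζ : Z => Ψ (Y a, ζ)) ζ :=
    (hc l).comp_continuous (continuous_id.prodMk continuous_const) fun a => ⟨Set.mem_univ _, hζ⟩
  have hsupp : HasCompactSupport fun a : A => iteratedFDeriv ℝ l (fun ζ : Z => Ψ (Y a, ζ)) ζ :=
    HasCompactSupport.intro (hYp K₀ hK₀) fun a ha => iteratedFDeriv_eq_zero_of_forall_mem_eq_zero hU (fun ζ' _ => h0 (Y a) ζ' ha) l hζ
  exact hcont.integrable_of_hasCompactSupport hsupp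

end Slot

end Literature.Analysis.Calculus

namespace Literature.NumberTheory.Automorphic.RankOneCasimir

open _root_.Complex _root_.Matrix _root_.MeasureTheory _root_.Set _root_.Filter _root_.Topology _root_.NumberField _root_.NumberField.InfinitePlace
open _root_.Literature.NumberTheory.Automorphic _root_.Literature.NumberTheory.Automorphic.UnitaryGroup _root_.Literature.Analysis.Calculus
open scoped Matrix.Norms.Operator MatrixGroups ComplexConjugate ContDiff Real

/-! ## §4 The outer datum: conjugating a regular torus point is proper onto compacta -/

section Proper

variable (L : Type) [Field L] (a : Fin 2 → L) (w : {w : InfinitePlace L // IsComplex w})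

/-- **The conjugation map `h ↦ ↑↑(h t_z(t) h⁻¹)` at a REGULAR angle is proper onto compacta of `M₂(ℂ)`** (`sin t ≠ 0`): `{h | ↑↑(h t_z(t) h⁻¹) ∈ K₀}` is compact for compact `K₀`
(★ `isCompact_setOf_coe_archLocal_mem` + ★ `isCompact_setOf_exists_conj_circleDiagonal_mem` over the singleton arc, ★ `torusPoint_ne`). [cite: Rogawski1990, §8.2 p. 122] [cite: Varadarajan1989, §6.4] -/
theorem isCompact_preimage_conj_torusPoint (ha : ∀ i, a i ≠ 0) (z : Circle) {t : ℝ} (ht : Real.sin t ≠ 0)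
    {K₀ : Set (Matrix (Fin 2) (Fin 2) ℂ)} (hK₀ : IsCompact K₀) :
    IsCompact ((fun h : unitaryGroupOfForm (starRingEnd ℂ) ((Matrix.diagonal a).map w.1.embedding) =>
      (((h * ⟨circleDiagonal 2 ![z * Circle.exp t, z * Circle.exp (-t)], circleDiagonal_mem_archLocal_diagonal L 2 a w _⟩ * h⁻¹ :
        unitaryGroupOfForm (starRingEnd ℂ) ((Matrix.diagonal a).map w.1.embedding)) : GL (Fin 2) ℂ) : Matrix (Fin 2) (Fin 2) ℂ)) ⁻¹' K₀) := by
  have hC' := isCompact_setOf_coe_archLocal_mem L 2 a w ha hK₀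
  have hKreg : ({![z * Circle.exp t, z * Circle.exp (-t)]} : Set (Fin 2 → Circle)) ⊆ {s : Fin 2 → Circle | Function.Injective s} := by
    rintro _ rfl
    intro i j hij
    fin_cases i <;> fin_cases j
    · rfl
    · exact absurd hij (torusPoint_ne z ht)
    · exact absurd hij.symm (torusPoint_ne z ht)
    · rfl
  have hS := isCompact_setOf_exists_conj_circleDiagonal_mem L 2 a w ha isCompact_singleton hKreg hC'
  have hcont : Continuous fun h : unitaryGroupOfForm (starRingEnd ℂ) ((Matrix.diagonal a).map w.1.embedding) =>
      (((h * ⟨circleDiagonal 2 ![z * Circle.exp t, z * Circle.exp (-t)], circleDiagonal_mem_archLocal_diagonal L 2 a w _⟩ * h⁻¹ :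
        unitaryGroupOfForm (starRingEnd ℂ) ((Matrix.diagonal a).map w.1.embedding)) : GL (Fin 2) ℂ) : Matrix (Fin 2) (Fin 2) ℂ) :=
    (Units.continuous_val.comp continuous_subtype_val).comp ((continuous_id.mul continuous_const).mul continuous_id.inv)
  exact hS.of_isClosed_subset (hK₀.isClosed.preimage hcont) fun h hh => ⟨_, Set.mem_singleton _, hh⟩

end Proper

end Literature.NumberTheory.Automorphic.RankOneCasimir

end
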